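import Literature.NumberTheory.Automorphic.HyperspecialUnitarySphericalCharacters
import Mathlib.RingTheory.Ideal.Pointwise
import HarnessLib

/-!
# The unramified eigencharacters `λ_β` of `ℋ(U(σ, J₀), K₀)` are parametrised by the `W`-orbits of torus characters
# (Cartier 1979 §IV Cor. 4.2, uniqueness, in every rank)

Topic `NumberTheory/Automorphic`; namespace `Literature.NumberTheory.Automorphic.HermitianLattice[.UnramifiedLocalConjDatum]`
(lane `lit-hodgefound`, Track 2 foundations; seat `lit-hodgefound-p11`, generation 48, row g48-#10).  One DEFINITION with body
(`antisymmEvalChar`) + theorems; no named fact, no instance, no notation.  Sequel of `HyperspecialUnitarySphericalCharacters` (existence: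
every character is a `λ_β`).

## The mathematics

`G = U_N`, `K₀`, `𝒮 : ℋ(G, K₀) ⥲ ℂ[Λ⁻]^W`, `W = C_{S_N}(rev)`, `λ_β(T) = 𝒮(T)(β)` as before.  [CartierCorvallis1979] §IV Cor. 4.2:
«`λ_χ = λ_{χ'}` iff `χ' ∈ W χ`».  Here the torus characters are the restrictions `χ_β = (μ ↦ β^μ)|_{Λ⁻}` of monomial characters,
and the THEOREM reads: **`λ_{β'} = λ_β` iff there is `π ∈ W` with `β'^μ = β^{μ ∘ π}` for all `μ ∈ Λ⁻`.**  (⇐) the coefficients of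
`𝒮(T)` are `W`-invariant (`HyperspecialUnitarySatakeImage`).  (⇒) `λ_β = ev_{χ_β} ∘ 𝒮` where `ev_χ : ℂ[Λ⁻] → ℂ`; if
`λ_{β'} = λ_β` then `ev_{χ_{β'}}` and `ev_{χ_β}` agree on `ℂ[Λ⁻]^W` (`𝒮` is onto it), so their kernels are maximal ideals of
`ℂ[Λ⁻]` over the same maximal ideal of `ℂ[Λ⁻]^W`; the finite group `W` acts transitively on those (Mathlib's
`Algebra.IsInvariant.exists_smul_of_under_eq`, [BourbakiAC5to7] V §2 no. 2 Thm. 2), so `ker ev_{χ_{β'}} = g · ker ev_{χ_β}` for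
some `g ∈ W`, whence `ev_{χ_{β'}} = ev_{χ_β} ∘ g⁻¹` and `χ_{β'} = χ_β ∘ g` on `Λ⁻`.

## What is formalised

* §1 `antisymmEvalChar β = ev_{χ_β} : ℂ[Λ⁻] →ₐ[ℂ] ℂ`, `laurentEvalAt_embLaurent` (`ev_β(ι_* b) = antisymmEvalChar β b`), `evalChar_single_one`,
  `algHom_eq_of_ker_le` (a character into the base field is determined by its kernel),
  `lift_comp_toMultiplicative_eq_lift_domCongr`, `evalChar_inv_smul_single_one` (`ev_{χ_β}(g⁻¹ • x^m) = β^{m ∘ g}`),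
  `exists_satakeTransform_eq_embLaurent` (every `b ∈ ℂ[Λ⁻]^W` is `ι_*⁻¹ 𝒮(T)`), `heckeEigencharacter_eq_evalChar`.
* §2 **`heckeEigencharacter_eq_of_exists_perm`** (⇐), **`exists_perm_of_heckeEigencharacter_eq`** (⇒) and
  **`heckeEigencharacter_eq_iff_exists_perm`** (Cor. 4.2, uniqueness up to `W`, every rank).

## References
* [CartierCorvallis1979] P. Cartier, *Representations of 𝔭-adic groups: a survey*, PSPM 33.1 (1979), §IV Cor. 4.2.
* [BourbakiAC5to7] N. Bourbaki, *Algèbre commutative*, Ch. V §2 no. 2 Thm. 2 (transitivity of a finite group on the primes over a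
  prime of the invariants).
* [Satake1963] I. Satake, *Theory of spherical functions on reductive algebraic groups over 𝔭-adic fields*, Publ. Math. IHÉS 18
  (1963), §6.
* [Minguez2011] A. Mínguez, *Unramified representations of unitary groups*, in: *On the stabilization of the trace formula* (2011), §4.
-/

noncomputable section

open scoped Valued WithZero Matrix MatrixGroups Pointwise
open MonoidAlgebra Representation

namespace Literature.NumberTheory.Automorphic.HermitianLattice

open Literature.NumberTheory.Automorphic Literature.NumberTheory.Automorphic.CartanUnique

variable {N : ℕ}

/-! ## §1 The characters `ev_{χ_β}` of `ℂ[Λ⁻]` -/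

section EvalChar

/-- **`ev_{χ_β} : ℂ[Λ⁻] → ℂ`**, evaluation at the restriction `χ_β = (μ ↦ β^μ)|_{Λ⁻}` of the monomial character of `β ∈ (ℂˣ)^N`.
[cite: CartierCorvallis1979, §IV Cor. 4.2] -/
def antisymmEvalChar (β : Fin N → ℂˣ) : AddMonoidAlgebra ℂ (antisymmLattice N) →ₐ[ℂ] ℂ :=
  AddMonoidAlgebra.lift ℂ ℂ (antisymmLattice N)
    ((laurentMonomialHom β).comp (AddMonoidHom.toMultiplicative (antisymmLattice N).subtype))

/-- `ev_β(ι_* b) = ev_{χ_β}(b)`. [cite: CartierCorvallis1979, §IV Cor. 4.2] -/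
theorem laurentEvalAt_embLaurent (β : Fin N → ℂˣ) (b : AddMonoidAlgebra ℂ (antisymmLattice N)) :
    laurentEvalAt β (embLaurent N b) = antisymmEvalChar β b := by
  rw [laurentEvalAt, embLaurent_apply, lift_mapDomain]
  rfl

/-- `ev_{χ_β}(x^m) = β^m`. [cite: CartierCorvallis1979, §IV Cor. 4.2] -/
theorem evalChar_single_one (β : Fin N → ℂˣ) (m : antisymmLattice N) :
    antisymmEvalChar β (AddMonoidAlgebra.single m 1) = laurentMonomialHom β (Multiplicative.ofAdd (m : Fin N → ℤ)) := by
  rw [antisymmEvalChar, AddMonoidAlgebra.lift_single, one_smul]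
  rfl

/-- A character of a `k`-algebra with values in `k` is determined by its kernel. [cite: BourbakiAC5to7, Ch. V §2 no. 2] -/
theorem algHom_eq_of_ker_le {k B : Type*} [Field k] [CommRing B] [Algebra k B] (φ₁ φ₂ : B →ₐ[k] k)
    (h : RingHom.ker φ₁ ≤ RingHom.ker φ₂) : φ₂ = φ₁ := by
  refine AlgHom.ext fun b => ?_
  have hb : b - algebraMap k B (φ₁ b) ∈ RingHom.ker φ₁ := by
    rw [RingHom.mem_ker, map_sub, AlgHom.commutes, Algebra.algebraMap_self, RingHom.id_apply, sub_self]
  have h2 := h hb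
  rw [RingHom.mem_ker, map_sub, AlgHom.commutes, Algebra.algebraMap_self, RingHom.id_apply, sub_eq_zero] at h2
  exact h2

/-- **`ev_{χ∘e}(f) = ev_χ(e_* f)`** (naturality of evaluation under a lattice automorphism `e`). [cite: CartierCorvallis1979, §IV (4.2)–(4.4)] -/
theorem lift_comp_toMultiplicative_eq_lift_domCongr {R : Type*} [CommRing R] {Λ : Type*} [AddCommGroup Λ] (e : Λ ≃+ Λ)
    (χ : Multiplicative Λ →* R) (f : AddMonoidAlgebra R Λ) :
    AddMonoidAlgebra.lift R R Λ (χ.comp (AddMonoidHom.toMultiplicative e.toAddMonoidHom)) f =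
      AddMonoidAlgebra.lift R R Λ χ (AddMonoidAlgebra.domCongr R R e f) := by
  induction f using AddMonoidAlgebra.induction_linear with
  | zero => rw [map_zero, map_zero, map_zero]
  | add f g hf hg => rw [map_add, map_add, map_add, hf, hg]
  | single m c => rw [AddMonoidAlgebra.domCongr_single, AddMonoidAlgebra.lift_single, AddMonoidAlgebra.lift_single]; rfl

/-- `ev_{χ_β}(g⁻¹ • x^m) = β^{m ∘ g}`. [cite: CartierCorvallis1979, §IV Cor. 4.2] -/
theorem evalChar_inv_smul_single_one (β : Fin N → ℂˣ) (g : revCentralizer N) (m : antisymmLattice N) :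
    antisymmEvalChar β (letI := weylAction N; g⁻¹ • AddMonoidAlgebra.single m (1 : ℂ)) =
      laurentMonomialHom β (Multiplicative.ofAdd ((m : Fin N → ℤ) ∘ ⇑(g : Equiv.Perm (Fin N)))) := by
  rw [weylAction_smul, AddMonoidAlgebra.domCongr_single, evalChar_single_one, coe_antisymmLatticeCongr, Subgroup.coe_inv, inv_inv]

variable {K : Type*} [Field K] [Valued K ℤᵐ⁰] {σ : K →+* K} {ϖ : K}

namespace UnramifiedLocalConjDatum

/-- **Every `b ∈ ℂ[Λ⁻]^W` is `ι_*⁻¹ 𝒮(T)` for some `T`** (the Satake isomorphism). [cite: CartierCorvallis1979, §IV Thm. 4.1] -/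
theorem exists_satakeTransform_eq_embLaurent (hd : UnramifiedLocalConjDatum σ ϖ) [Finite 𝓀[K]] (hσ : ∃ x : K, σ x ≠ x)
    {b : AddMonoidAlgebra ℂ (antisymmLattice N)} (hb : ∀ π : revCentralizer N, (letI := weylAction N; π • b) = b) :
    ∃ T : heckeAlgebra ℂ (unitaryGroupOfForm σ ((StdForm.antidiagonal N).over K)) (unitaryInt σ ((StdForm.antidiagonal N).over K)),
      hd.satakeTransform T = embLaurent N b :=
  hd.exists_satakeTransform_eq hσ _ ((forall_smul_eq_self_iff_mem_unitarySatakeTarget b).1 hb)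

/-- `λ_β(T) = ev_{χ_β}(b)` when `𝒮(T) = ι_* b`. [cite: CartierCorvallis1979, §IV Cor. 4.2] -/
theorem heckeEigencharacter_eq_evalChar (hd : UnramifiedLocalConjDatum σ ϖ) [Finite 𝓀[K]] (β : Fin N → ℂˣ)
    {T : heckeAlgebra ℂ (unitaryGroupOfForm σ ((StdForm.antidiagonal N).over K)) (unitaryInt σ ((StdForm.antidiagonal N).over K))}
    {b : AddMonoidAlgebra ℂ (antisymmLattice N)} (h : hd.satakeTransform T = embLaurent N b) :
    hd.heckeEigencharacter β T = antisymmEvalChar β b := by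
  rw [hd.heckeEigencharacter_apply, h, laurentEvalAt_embLaurent]

end UnramifiedLocalConjDatum

end EvalChar

/-! ## §2 `λ_{β'} = λ_β ⟺ χ_{β'} ∈ W · χ_β` -/

section Unique

variable {K : Type*} [Field K] [Valued K ℤᵐ⁰] {σ : K →+* K} {ϖ : K}

namespace UnramifiedLocalConjDatum

/-- **(⇐) `W`-conjugate torus characters give the same eigencharacter**: if `β'^μ = β^{μ ∘ π}` on `Λ⁻` for some `π ∈ W`, then
`λ_{β'} = λ_β` (the coefficients of `𝒮(T)` are `W`-invariant). [cite: CartierCorvallis1979, §IV Cor. 4.2] [cite: Minguez2011, §4] -/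
theorem heckeEigencharacter_eq_of_exists_perm (hd : UnramifiedLocalConjDatum σ ϖ) [Finite 𝓀[K]] (hσ : ∃ x : K, σ x ≠ x)
    {β β' : Fin N → ℂˣ} {π : Equiv.Perm (Fin N)} (hπ : ∀ i, π (Fin.rev i) = Fin.rev (π i))
    (h : ∀ μ : Fin N → ℤ, (∀ i, μ (Fin.rev i) = -μ i) →
      laurentMonomialHom β' (Multiplicative.ofAdd μ) = laurentMonomialHom β (Multiplicative.ofAdd (μ ∘ ⇑π))) :
    hd.heckeEigencharacter β' = hd.heckeEigencharacter β := by
  letI := weylAction N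
  refine AlgHom.ext fun T => ?_
  have hST := hd.satakeTransform_mem_unitarySatakeTarget hσ T
  obtain ⟨b, hb⟩ := (AlgHom.mem_range _).1 (((mem_unitarySatakeTarget_iff _).1 hST).1 |> (mem_antisymmSupported_iff _).2)
  have hb' : hd.satakeTransform T = embLaurent N b := hb.symm
  have hfix : ∀ ρ : revCentralizer N, ρ • b = b :=
    (forall_smul_eq_self_iff_mem_unitarySatakeTarget b).2 (by rw [← hb']; exact hST)
  rw [hd.heckeEigencharacter_eq_evalChar β' hb', hd.heckeEigencharacter_eq_evalChar β hb']
  -- `χ_{β'} = χ_β ∘ e` with `e = (π⁻¹ · ) = (μ ↦ μ ∘ π)` on `Λ⁻`, and `b` is `e`-invariant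
  set g : revCentralizer N := ⟨π, hπ⟩ with hg
  have hchar : (laurentMonomialHom β').comp (AddMonoidHom.toMultiplicative (antisymmLattice N).subtype) =
      ((laurentMonomialHom β).comp (AddMonoidHom.toMultiplicative (antisymmLattice N).subtype)).comp
        (AddMonoidHom.toMultiplicative (antisymmLatticeCongr g⁻¹).toAddMonoidHom) := by
    refine MonoidHom.ext fun m => ?_
    show laurentMonomialHom β' (Multiplicative.ofAdd ((Multiplicative.toAdd m : antisymmLattice N) : Fin N → ℤ)) =
      laurentMonomialHom β (Multiplicative.ofAdd ((antisymmLatticeCongr g⁻¹ (Multiplicative.toAdd m) : antisymmLattice N) : Fin N → ℤ))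
    rw [h _ (Multiplicative.toAdd m).2, coe_antisymmLatticeCongr, Subgroup.coe_inv, inv_inv]
  rw [antisymmEvalChar, antisymmEvalChar, hchar, lift_comp_toMultiplicative_eq_lift_domCongr]
  exact congrArg _ (hfix g⁻¹)

/-- **(⇒) Equal eigencharacters have `W`-conjugate torus characters**: if `λ_{β'} = λ_β` then `β'^μ = β^{μ ∘ π}` on `Λ⁻` for some
`π ∈ W` (transitivity of `W` on the maximal ideals of `ℂ[Λ⁻]` over a maximal ideal of `ℂ[Λ⁻]^W`).
[cite: CartierCorvallis1979, §IV Cor. 4.2] [cite: BourbakiAC5to7, Ch. V §2 no. 2 Thm. 2] -/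
theorem exists_perm_of_heckeEigencharacter_eq (hd : UnramifiedLocalConjDatum σ ϖ) [Finite 𝓀[K]] (hσ : ∃ x : K, σ x ≠ x)
    {β β' : Fin N → ℂˣ} (h : hd.heckeEigencharacter β' = hd.heckeEigencharacter β) :
    ∃ π : Equiv.Perm (Fin N), (∀ i, π (Fin.rev i) = Fin.rev (π i)) ∧
      ∀ μ : Fin N → ℤ, (∀ i, μ (Fin.rev i) = -μ i) →
        laurentMonomialHom β' (Multiplicative.ofAdd μ) = laurentMonomialHom β (Multiplicative.ofAdd (μ ∘ ⇑π)) := by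
  classical
  letI := weylAction N
  -- `A = ℂ[Λ⁻]^W ⊆ B = ℂ[Λ⁻]`
  set A : Subalgebra ℂ (AddMonoidAlgebra ℂ (antisymmLattice N)) := (unitarySatakeTarget ℂ N).comap (embLaurent N) with hAdef
  have hAfix : ∀ b : AddMonoidAlgebra ℂ (antisymmLattice N), b ∈ A ↔ ∀ g : revCentralizer N, g • b = b := fun b =>
    (Subalgebra.mem_comap _ _ _).trans (forall_smul_eq_self_iff_mem_unitarySatakeTarget b).symm
  haveI : Algebra.IsInvariant A (AddMonoidAlgebra ℂ (antisymmLattice N)) (revCentralizer N) :=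
    ⟨fun b hb => ⟨⟨b, (hAfix b).2 hb⟩, rfl⟩⟩
  haveI : SMulCommClass (revCentralizer N) A (AddMonoidAlgebra ℂ (antisymmLattice N)) :=
    ⟨fun g a b => by
      rw [Algebra.smul_def, Algebra.smul_def, smul_mul']
      show g • (a : AddMonoidAlgebra ℂ (antisymmLattice N)) * g • b = (a : AddMonoidAlgebra ℂ (antisymmLattice N)) * g • b
      rw [(hAfix a.1).1 a.2 g]⟩
  -- the two characters agree on `A`, so their kernels lie over the same maximal ideal of `A`
  have hagree : ∀ a : A, antisymmEvalChar β' (a : AddMonoidAlgebra ℂ (antisymmLattice N)) = antisymmEvalChar β a := fun a => by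
    obtain ⟨T, hT⟩ := hd.exists_satakeTransform_eq_embLaurent hσ ((hAfix a.1).1 a.2)
    rw [← hd.heckeEigencharacter_eq_evalChar β' hT, ← hd.heckeEigencharacter_eq_evalChar β hT, h]
  have hsurj : ∀ γ : Fin N → ℂˣ, Function.Surjective (antisymmEvalChar (N := N) γ) := fun γ c =>
    ⟨algebraMap ℂ _ c, AlgHom.commutes _ c⟩
  haveI hM : (RingHom.ker (antisymmEvalChar β)).IsMaximal := RingHom.ker_isMaximal_of_surjective _ (hsurj β)
  haveI hM' : (RingHom.ker (antisymmEvalChar β')).IsMaximal := RingHom.ker_isMaximal_of_surjective _ (hsurj β')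
  have hunder : (RingHom.ker (antisymmEvalChar β)).under A = (RingHom.ker (antisymmEvalChar β')).under A := by
    refine Ideal.ext fun a => ?_
    change a ∈ (RingHom.ker (antisymmEvalChar β)).comap (algebraMap A _) ↔ a ∈ (RingHom.ker (antisymmEvalChar β')).comap (algebraMap A _)
    rw [Ideal.mem_comap, Ideal.mem_comap, RingHom.mem_ker, RingHom.mem_ker]
    show antisymmEvalChar β (a : AddMonoidAlgebra ℂ (antisymmLattice N)) = 0 ↔ antisymmEvalChar β' (a : AddMonoidAlgebra ℂ (antisymmLattice N)) = 0
    rw [hagree]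
  obtain ⟨g, hg⟩ := Algebra.IsInvariant.exists_smul_of_under_eq (A := A) (B := AddMonoidAlgebra ℂ (antisymmLattice N))
    (G := revCentralizer N) (P := RingHom.ker (antisymmEvalChar β)) (Q := RingHom.ker (antisymmEvalChar β')) hunder
  -- `ev_{χ_{β'}} = ev_{χ_β} ∘ (g⁻¹ • ·)`: both are characters with the same kernel
  set Φ : AddMonoidAlgebra ℂ (antisymmLattice N) →ₐ[ℂ] ℂ := (antisymmEvalChar β).comp (weylAlgAut N g⁻¹ : _ ≃ₐ[ℂ] _).toAlgHom with hΦ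
  have hΦapply : ∀ b, Φ b = antisymmEvalChar β (g⁻¹ • b) := fun b => rfl
  have hker : RingHom.ker Φ ≤ RingHom.ker (antisymmEvalChar β') := fun b hb => by
    rw [RingHom.mem_ker] at hb ⊢
    have h1 : g⁻¹ • b ∈ RingHom.ker (antisymmEvalChar β) := by rw [RingHom.mem_ker]; exact hb
    have h2 : b ∈ g • RingHom.ker (antisymmEvalChar β) := Ideal.mem_pointwise_smul_iff_inv_smul_mem.2 h1
    rw [← hg, RingHom.mem_ker] at h2
    exact h2
  have heq : antisymmEvalChar β' = Φ := algHom_eq_of_ker_le Φ (antisymmEvalChar β') hker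
  refine ⟨(g : Equiv.Perm (Fin N)), g.2, fun μ hμ => ?_⟩
  have h1 : antisymmEvalChar β' (AddMonoidAlgebra.single ⟨μ, hμ⟩ 1) = Φ (AddMonoidAlgebra.single ⟨μ, hμ⟩ 1) := by rw [heq]
  rw [hΦapply, evalChar_inv_smul_single_one, evalChar_single_one] at h1
  exact h1

/-- **CARTIER COR. 4.2 FOR `U(σ, J₀^{(N)})`, UNIQUENESS UP TO `W`, EVERY RANK**: `λ_{β'} = λ_β` iff the torus characters
`χ_{β'} = (β'^·)|_{Λ⁻}` and `χ_β` are `W`-conjugate: `∃ π ∈ C_{S_N}(rev), β'^μ = β^{μ ∘ π}` for all `μ ∈ Λ⁻`.  With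
`HyperspecialUnitarySphericalCharacters.exists_eq_heckeEigencharacter`: `Hom_{ℂ-alg}(ℋ(U_N, K₀), ℂ) ≅ {χ_β} / W`.
[cite: CartierCorvallis1979, §IV Cor. 4.2] [cite: Satake1963, §6] [cite: Minguez2011, §4] -/
theorem heckeEigencharacter_eq_iff_exists_perm (hd : UnramifiedLocalConjDatum σ ϖ) [Finite 𝓀[K]] (hσ : ∃ x : K, σ x ≠ x)
    (β β' : Fin N → ℂˣ) :
    hd.heckeEigencharacter β' = hd.heckeEigencharacter β ↔
      ∃ π : Equiv.Perm (Fin N), (∀ i, π (Fin.rev i) = Fin.rev (π i)) ∧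
        ∀ μ : Fin N → ℤ, (∀ i, μ (Fin.rev i) = -μ i) →
          laurentMonomialHom β' (Multiplicative.ofAdd μ) = laurentMonomialHom β (Multiplicative.ofAdd (μ ∘ ⇑π)) :=
  ⟨hd.exists_perm_of_heckeEigencharacter_eq hσ, fun ⟨_, hπ, h⟩ => hd.heckeEigencharacter_eq_of_exists_perm hσ hπ h⟩

end UnramifiedLocalConjDatum

end Unique

end Literature.NumberTheory.Automorphic.HermitianLattice

end
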